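import Summits.ValiantsHypothesis.ValiantsHypothesis.Theorems.BarrierLeverAnchoredDoorHitsLowerPairsTropical
import Summits.ValiantsHypothesis.ValiantsHypothesis.Theorems.BarrierLeverPartitionMinorsHitByVPExactCoverNoGoPrelims

/-!
# Support item `AnchoredDoorHitsLowerPairs` (stmt-ValiantsHypothesis-22510), line `anchored-peeling`:
# DISTINCT ANCHORS, part 2 — the distinct-anchor specialisation and its entries

Helper file (`--supports stmt-ValiantsHypothesis-22510`; cell valiant-natproofs, rung V4, 𝒟-side door (c); registered line
`Cruxes/AnchoredDoorHitsLowerPairs/Lines/anchored_peeling.lean` v3; prover seat val-np-p4 gen 16). Bookkeeping `def`s `core`, `tailMon`,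
`daSpec`. Closes NO item.

The specialisation `daSpec K` attached to a set `K` of anchors sends `θ_α ↦ T` for `α ∈ K`, `θ_α ↦ 0` otherwise, and keeps every twist
as a constant of `R[T]`, `R = ℂ[θ, φ, ψ]`. The specialised symbolic witness is `∏_{α ∈ K} (1 + T · core α)` with
`core α = x^A y^B ∏_{b ∉ A}(1 + φ_{α b} x_b) ∏_{d ∉ B}(1 + ψ_{α d} y_d)` (`map_daSpec_symbolicWitness`), hence every layout entry is
`Σ_{J ⊆ K} T^{|J|} · [x^U y^W] ∏_{α ∈ J} core α` (`entry_eq`, `coeff_entry`), with constant term `[U = ∅ ∧ W = ∅]` (`coeff_entry_zero`) and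
FIRST-ORDER term `Σ_{α ∈ K} [A ⊆ U][B ⊆ W] · tailMon α U W` (`coeff_entry_one`, from `coeff_core`:
`[x^U y^W] core α = [A ⊆ U][B ⊆ W] ∏_{b ∈ U∖A} φ_{α b} ∏_{d ∈ W∖B} ψ_{α d}`). Part 3 (`…DistinctAnchors`) turns this into the certificate
«distinct anchors inside the matched entries ⇒ `symbolicDet ≠ 0`».

WHAT THIS IS NOT: nothing on items 22510 / 19717 themselves, on crux stmt-ValiantsHypothesis-14610, or on `VP` versus `VNP`.
-/
set_option linter.dupNamespace false

namespace Summit.ValiantsHypothesis.ValiantsHypothesis.Theorems.BarrierLever.AnchoredPeeling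

open Finset MvPolynomial
open Summit.ValiantsHypothesis.ValiantsHypothesis.Theorems.BarrierLever.BrickCalculus (pexpo pexpo_def pexpo_le_iff pexpo_sub)
open Summit.ValiantsHypothesis.ValiantsHypothesis.Theorems.BarrierLever.ExactCoverNoGo (pexpo_eq_zero_iff)

noncomputable section

namespace DistinctAnchors

variable {h : ℕ}

/-! ## 1. The core of an anchor factor and its layout coefficients -/

/-- The `θ`-free core of the anchor factor of `α = (A | B)`: `x^A y^B · ∏_{b ∉ A} (1 + φ_{α b} x_b) · ∏_{d ∉ B} (1 + ψ_{α d} y_d)`. -/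
def core (α : Finset (Fin h) × Finset (Fin h)) : MvPolynomial (Fin (h + h)) (MvPolynomial (Param h) ℂ) :=
  (∏ a ∈ α.1, X (Fin.castAdd h a)) * (∏ c ∈ α.2, X (Fin.natAdd h c)) *
    ((∏ b ∈ univ \ α.1, (1 + C (X (Sum.inr (Sum.inl (α, b)))) * X (Fin.castAdd h b))) *
     (∏ d ∈ univ \ α.2, (1 + C (X (Sum.inr (Sum.inr (α, d)))) * X (Fin.natAdd h d))))

/-- The anchor factor is `1 + θ_α · core α`. -/
theorem symbFactor_eq_core (α : Finset (Fin h) × Finset (Fin h)) : symbFactor h α = 1 + C (X (Sum.inl α)) * core α := by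
  rw [symbFactor, core]; ring

/-- The tail monomial of the anchor `α` on the entry `(U, W)`: `∏_{b ∈ U ∖ A} φ_{α b} · ∏_{d ∈ W ∖ B} ψ_{α d}`. -/
def tailMon (α : Finset (Fin h) × Finset (Fin h)) (U W : Finset (Fin h)) : MvPolynomial (Param h) ℂ :=
  (∏ b ∈ U \ α.1, X (Sum.inr (Sum.inl (α, b)))) * (∏ d ∈ W \ α.2, X (Sum.inr (Sum.inr (α, d))))

/-- `pexpo` is injective. -/
theorem pexpo_inj {S S' D D' : Finset (Fin h)} (heq : pexpo S S' = pexpo D D') : S = D ∧ S' = D' := by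
  have h1 := (pexpo_le_iff S S' D D').mp heq.le
  have h2 := (pexpo_le_iff D D' S S').mp heq.ge
  exact ⟨Finset.Subset.antisymm h1.1 h2.1, Finset.Subset.antisymm h1.2 h2.2⟩

/-- The product of the two tail products, expanded: `Σ_{S ⊆ Aᶜ, S' ⊆ Bᶜ} monomial (x^S y^{S'}) (φ^S ψ^{S'})`. -/
theorem tails_eq_sum (α : Finset (Fin h) × Finset (Fin h)) :
    ((∏ b ∈ univ \ α.1, (1 + C (X (Sum.inr (Sum.inl (α, b)))) * X (Fin.castAdd h b))) *
     (∏ d ∈ univ \ α.2, (1 + C (X (Sum.inr (Sum.inr (α, d)))) * X (Fin.natAdd h d))) :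
      MvPolynomial (Fin (h + h)) (MvPolynomial (Param h) ℂ)) =
    ∑ S ∈ (univ \ α.1).powerset, ∑ S' ∈ (univ \ α.2).powerset,
      monomial (pexpo S S') ((∏ b ∈ S, X (Sum.inr (Sum.inl (α, b)))) * (∏ d ∈ S', X (Sum.inr (Sum.inr (α, d))))) := by
  rw [ProductRule.prod_one_add_C_mul_X_fun (fun b => X (Sum.inr (Sum.inl (α, b)))) (univ \ α.1) (Fin.castAdd h),
    ProductRule.prod_one_add_C_mul_X_fun (fun d => X (Sum.inr (Sum.inr (α, d)))) (univ \ α.2) (Fin.natAdd h),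
    Finset.sum_mul_sum]
  refine Finset.sum_congr rfl (fun S _ => Finset.sum_congr rfl (fun S' _ => ?_))
  rw [monomial_mul, pexpo_def]

/-- **Layout coefficients of the core:** `[x^U y^W] core α = [A ⊆ U][B ⊆ W] · tailMon α U W`. -/
theorem coeff_core (α : Finset (Fin h) × Finset (Fin h)) (U W : Finset (Fin h)) :
    coeff (pexpo U W) (core α) = if (α.1 ⊆ U ∧ α.2 ⊆ W) then tailMon α U W else 0 := by
  classical
  rw [core, prod_X_eq_monomial', prod_X_eq_monomial', monomial_mul, mul_one, ← pexpo_def, coeff_monomial_mul']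
  by_cases hAB : α.1 ⊆ U ∧ α.2 ⊆ W
  · rw [if_pos ((pexpo_le_iff _ _ _ _).mpr hAB), if_pos hAB, one_mul, pexpo_sub _ _ _ _ hAB.1 hAB.2, tails_eq_sum,
      coeff_sum]
    have hSmem : U \ α.1 ∈ (univ \ α.1).powerset :=
      Finset.mem_powerset.mpr (Finset.sdiff_subset_sdiff (Finset.subset_univ _) subset_rfl)
    have hS'mem : W \ α.2 ∈ (univ \ α.2).powerset :=
      Finset.mem_powerset.mpr (Finset.sdiff_subset_sdiff (Finset.subset_univ _) subset_rfl)
    rw [Finset.sum_eq_single (U \ α.1)]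
    · rw [coeff_sum, Finset.sum_eq_single (W \ α.2)]
      · rw [coeff_monomial, if_pos rfl, tailMon]
      · intro S' _ hS'
        rw [coeff_monomial, if_neg (fun heq => hS' (pexpo_inj heq).2)]
      · intro hS'; exact absurd hS'mem hS'
    · intro S _ hS
      rw [coeff_sum]
      exact Finset.sum_eq_zero (fun S' _ => by rw [coeff_monomial, if_neg (fun heq => hS (pexpo_inj heq).1)])
    · intro hS; exact absurd hSmem hS
  · rw [if_neg (fun hle => hAB ((pexpo_le_iff _ _ _ _).mp hle)), if_neg hAB]

/-! ## 2. The distinct-anchor specialisation and the entries -/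

/-- The specialisation attached to a set `K` of anchors: `θ_α ↦ T` (`α ∈ K`), `θ_α ↦ 0` (`α ∉ K`), every twist kept as a constant. -/
def daSpec (K : Finset (Finset (Fin h) × Finset (Fin h))) : Param h → Polynomial (MvPolynomial (Param h) ℂ)
  | Sum.inl α => if α ∈ K then Polynomial.X else 0
  | Sum.inr v => Polynomial.C (X (Sum.inr v))

/-- Under the specialisation the twists of the core become constants. -/
theorem map_daSpec_core (K : Finset (Finset (Fin h) × Finset (Fin h))) (α : Finset (Fin h) × Finset (Fin h)) :
    MvPolynomial.map (aeval (daSpec K)).toRingHom (core α) = MvPolynomial.map Polynomial.C (core α) := by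
  rw [core]
  simp only [map_mul, map_prod, map_add, map_one, map_X, map_C, AlgHom.toRingHom_eq_coe, RingHom.coe_coe, aeval_X, daSpec]

/-- The specialised anchor factor. -/
theorem map_daSpec_symbFactor (K : Finset (Finset (Fin h) × Finset (Fin h))) (α : Finset (Fin h) × Finset (Fin h)) :
    MvPolynomial.map (aeval (daSpec K)).toRingHom (symbFactor h α) =
      if α ∈ K then 1 + C Polynomial.X * MvPolynomial.map Polynomial.C (core α) else 1 := by
  rw [symbFactor_eq_core, map_add, map_one, map_mul, map_C, map_daSpec_core, AlgHom.toRingHom_eq_coe, RingHom.coe_coe,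
    aeval_X, daSpec]
  split_ifs with hα
  · rfl
  · rw [map_zero, zero_mul, add_zero]

/-- **The specialised symbolic witness** (for `K ⊆ anchors s h`): `∏_{α ∈ K} (1 + T · core α)`. -/
theorem map_daSpec_symbolicWitness (s h : ℕ) (K : Finset (Finset (Fin h) × Finset (Fin h))) (hK : K ⊆ anchors s h) :
    MvPolynomial.map (aeval (daSpec K)).toRingHom (symbolicWitness s h) =
      ∏ α ∈ K, (1 + C Polynomial.X * MvPolynomial.map Polynomial.C (core α)) := by
  rw [symbolicWitness_eq_prod, map_prod,
    ← Finset.prod_subset hK (fun α _ hαK => by rw [map_daSpec_symbFactor, if_neg hαK])]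
  exact Finset.prod_congr rfl (fun α hα => by rw [map_daSpec_symbFactor, if_pos hα])

/-- Expanding `∏_{α ∈ K} (1 + T · core α) = Σ_{J ⊆ K} T^{|J|} · ∏_{α ∈ J} core α`. -/
theorem prod_one_add_T_mul (K : Finset (Finset (Fin h) × Finset (Fin h))) :
    (∏ α ∈ K, (1 + C Polynomial.X * MvPolynomial.map Polynomial.C (core α)) :
      MvPolynomial (Fin (h + h)) (Polynomial (MvPolynomial (Param h) ℂ))) =
      ∑ J ∈ K.powerset, C (Polynomial.X ^ J.card) * MvPolynomial.map Polynomial.C (∏ α ∈ J, core α) := by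
  rw [Finset.prod_one_add]
  refine Finset.sum_congr rfl (fun J _ => ?_)
  rw [Finset.prod_mul_distrib, Finset.prod_const, map_pow, map_prod]

/-- **The specialised entries:** `[x^U y^W] = Σ_{J ⊆ K} T^{|J|} · [x^U y^W] ∏_{α ∈ J} core α`. -/
theorem entry_eq (s h : ℕ) (K : Finset (Finset (Fin h) × Finset (Fin h))) (hK : K ⊆ anchors s h) (U W : Finset (Fin h)) :
    (aeval (daSpec K)).toRingHom (coeff (pexpo U W) (symbolicWitness s h)) =
      ∑ J ∈ K.powerset, Polynomial.C (coeff (pexpo U W) (∏ α ∈ J, core α)) * Polynomial.X ^ J.card := by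
  rw [← coeff_map, map_daSpec_symbolicWitness s h K hK, prod_one_add_T_mul, coeff_sum]
  refine Finset.sum_congr rfl (fun J _ => ?_)
  rw [coeff_C_mul, coeff_map, mul_comm]

/-- The `T^n`-coefficient of a specialised entry collects the `n`-element anchor sets. -/
theorem coeff_entry (s h : ℕ) (K : Finset (Finset (Fin h) × Finset (Fin h))) (hK : K ⊆ anchors s h) (U W : Finset (Fin h))
    (n : ℕ) :
    ((aeval (daSpec K)).toRingHom (coeff (pexpo U W) (symbolicWitness s h))).coeff n =
      ∑ J ∈ K.powersetCard n, coeff (pexpo U W) (∏ α ∈ J, core α) := by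
  rw [entry_eq s h K hK, Polynomial.finsetSum_coeff]
  simp only [Polynomial.coeff_C_mul_X_pow]
  rw [← Finset.sum_filter, Finset.powersetCard_eq_filter]
  exact Finset.sum_congr (by ext J; simp only [Finset.mem_filter, eq_comm]) (fun _ _ => rfl)

/-- Constant term of a specialised entry: `[U = ∅ ∧ W = ∅]`. -/
theorem coeff_entry_zero (s h : ℕ) (K : Finset (Finset (Fin h) × Finset (Fin h))) (hK : K ⊆ anchors s h) (U W : Finset (Fin h)) :
    ((aeval (daSpec K)).toRingHom (coeff (pexpo U W) (symbolicWitness s h))).coeff 0 =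
      if (U = ∅ ∧ W = ∅) then 1 else 0 := by
  classical
  rw [coeff_entry s h K hK, Finset.powersetCard_zero, Finset.sum_singleton, Finset.prod_empty, MvPolynomial.coeff_one]
  by_cases hUW : U = ∅ ∧ W = ∅
  · rw [if_pos hUW, if_pos ((pexpo_eq_zero_iff U W).mpr hUW).symm]
  · rw [if_neg hUW, if_neg (fun h0 => hUW ((pexpo_eq_zero_iff U W).mp h0.symm))]

/-- First-order term of a specialised entry: `Σ_{α ∈ K} [A ⊆ U][B ⊆ W] · tailMon α U W`. -/
theorem coeff_entry_one (s h : ℕ) (K : Finset (Finset (Fin h) × Finset (Fin h))) (hK : K ⊆ anchors s h) (U W : Finset (Fin h)) :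
    ((aeval (daSpec K)).toRingHom (coeff (pexpo U W) (symbolicWitness s h))).coeff 1 =
      ∑ α ∈ K, if (α.1 ⊆ U ∧ α.2 ⊆ W) then tailMon α U W else 0 := by
  classical
  rw [coeff_entry s h K hK, Finset.powersetCard_one, Finset.sum_map]
  refine Finset.sum_congr rfl (fun α _ => ?_)
  rw [Function.Embedding.coeFn_mk, Finset.prod_singleton, coeff_core]

end DistinctAnchors

end

end Summit.ValiantsHypothesis.ValiantsHypothesis.Theorems.BarrierLever.AnchoredPeeling
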